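import Mathlib.NumberTheory.Chebyshev
import Literature.NumberTheory.LFunctions.MertensElementary
import Literature.NumberTheory.LFunctions.MertensFormula
import HarnessLib

/-!
# Chebyshev–Mertens prime-sum estimates for Selberg's mean-value approximate formula for `S(t)`

Topic `Literature/NumberTheory/LFunctions`. Everything in this file is PROVED (theorems only; no
definitions, no named facts). Support file of the Selberg–Fujii cluster (`ZeroGaps.lean`,
`SelbergFujiiApproxFormula.lean`, `SelbergApproxPointwise.lean`, `SelbergSigmaXTMoments.lean`):
the elementary prime sums that enter the mean square of Selberg's approximate formula
`π S(t) + Σ_{p ≤ y} sin(t log p)/√p` (Selberg, *Contributions* (1946) §§5–6; Titchmarsh §§14.21–14.22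
for the shape of the argument under RH), namely

* `card_primesLE_le` — Chebyshev: `π(N) ≤ 5 N / log N` (`N ≥ 2`), from Mathlib's
  `Chebyshev.pi_le_log4_mul_div`; `card_block_le` — a dyadic block `2^j ≤ p < 2^{j+1}` holds at most
  `15 · 2^j/(j+1)` primes;
* `sum_log_pow_mul_rpow_le` — for `0 < u ≤ 1` and every `k`,
  `Σ_{p} (log p)^{k+1} p^{−1−2u} ≤ 60 · k! · u^{−(k+1)}` over any finite set of primes (dyadic blocks,
  Chebyshev on each block, `(j+1)^k ≤ k! e^{b(j+1)}/b^k` with `b = u log 2`, and the geometric series in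
  `2^{−u}`, `1 − 2^{−u} ≥ 2u/5`);
* `sum_log_sq_div_le` — `Σ_{p ≤ y} log² p / p ≤ log y (log y + 2)` (Mertens I);
* `sum_inv_primes_window_le` — `Σ_{y < p ≤ X} 1/p ≤ log log X − log log y + 16/log y` (Mertens II);
* `sum_nonprime_vonMangoldt_mul_le` and its specialisations `sum_nonprime_vonMangoldt_rpow_le`
  (`Σ_{n < N, n not prime} Λ(n) n^{−1/2} ≤ 2 log N + 7`) and `sum_nonprime_primePow_inv_le`
  (`Σ_{n < N prime power, not prime} 1/n ≤ 1`) — the higher prime powers.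

## References

* A. Selberg, *Contributions to the theory of the Riemann zeta-function*, Arch. Math. Naturvid. 48
  (1946) no. 5, 89–155, §§5–6.
* E. C. Titchmarsh, *The Theory of the Riemann Zeta-Function*, 2nd ed. rev. D. R. Heath-Brown (1986),
  §§14.21–14.22, §9.25. [cite: Titchmarsh1986, §14.22]
* G. H. Hardy, E. M. Wright, *An Introduction to the Theory of Numbers*, 6th ed. (2008), Thms 414,
  425, 427. [cite: HardyWright2008, Thm 425 (§22.6)]
-/

noncomputable section

open Finset Real
open scoped Nat.Prime

namespace Literature.NumberTheory.LFunctions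

namespace SelbergPrimes

/-! ### Chebyshev's bound for `π` and for dyadic blocks of primes -/

/-- **Chebyshev**: `π(N) ≤ 5 N/log N` for `N ≥ 2` (from Mathlib's
`π(x) ≤ log 4 · x / log √x + √x` and `√N ≤ 2N/log N`, `2 log 4 + 2 ≤ 5`). [cite: HardyWright2008, Thm 414] -/
theorem card_primesLE_le {N : ℕ} (hN : 2 ≤ N) :
    ((Nat.primesLE N).card : ℝ) ≤ 5 * N / Real.log N := by
  have hN1 : (1 : ℝ) < N := by exact_mod_cast hN
  have hN0 : (0 : ℝ) < N := by linarith
  have hlog : 0 < Real.log N := Real.log_pos hN1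
  have h := Chebyshev.pi_le_log4_mul_div hN1
  rw [Nat.floor_natCast, Real.log_sqrt hN0.le] at h
  rw [Nat.primesLE_card_eq_primeCounting]
  have hl4 : Real.log 4 ≤ 3 / 2 := by
    have := Real.log_two_lt_d9
    rw [show (4 : ℝ) = 2 ^ 2 by norm_num, Real.log_pow]; push_cast; linarith
  have hs0 : 0 < Real.sqrt N := Real.sqrt_pos.mpr hN0
  have hsq : Real.sqrt N * Real.sqrt N = N := Real.mul_self_sqrt hN0.le
  have hlogle : Real.log N ≤ 2 * Real.sqrt N := by
    have h1 := Real.log_le_sub_one_of_pos hs0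
    rw [Real.log_sqrt hN0.le] at h1; linarith
  have hs : Real.sqrt N ≤ 2 * N / Real.log N := by
    rw [le_div_iff₀ hlog]; nlinarith
  have h1 : Real.log 4 * N / (Real.log N / 2) = 2 * Real.log 4 * N / Real.log N := by
    field_simp
  rw [h1] at h
  calc ((π N : ℕ) : ℝ) ≤ 2 * Real.log 4 * N / Real.log N + Real.sqrt N := h
    _ ≤ 2 * (3 / 2) * N / Real.log N + 2 * N / Real.log N := by gcongr
    _ = 5 * N / Real.log N := by ring

/-- The primes of the dyadic block `2^j ≤ p < 2^{j+1}` (i.e. `Nat.log 2 p = j`) inside any finite set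
of primes number at most `π(2^{j+1}) ≤ 15 · 2^j/(j+1)`. [cite: HardyWright2008, Thm 414] -/
theorem card_block_le (S : Finset ℕ) (hS : ∀ p ∈ S, p.Prime) (j : ℕ) :
    ((S.filter fun p ↦ Nat.log 2 p = j).card : ℝ) ≤ 15 * 2 ^ j / (j + 1) := by
  have hsub : (S.filter fun p ↦ Nat.log 2 p = j) ⊆ Nat.primesLE (2 ^ (j + 1)) := by
    intro p hp
    rw [Finset.mem_filter] at hp
    rw [Nat.mem_primesLE]
    refine ⟨?_, hS p hp.1⟩
    have := Nat.lt_pow_succ_log_self (b := 2) (by norm_num) p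
    rw [hp.2] at this
    exact this.le
  have h2 : (2 : ℕ) ≤ 2 ^ (j + 1) := by
    calc (2 : ℕ) = 2 ^ 1 := by norm_num
      _ ≤ 2 ^ (j + 1) := Nat.pow_le_pow_right (by norm_num) (by omega)
  have hcard : ((S.filter fun p ↦ Nat.log 2 p = j).card : ℝ) ≤
      ((Nat.primesLE (2 ^ (j + 1))).card : ℝ) := by
    exact_mod_cast Finset.card_le_card hsub
  refine hcard.trans ((card_primesLE_le h2).trans ?_)
  have hlog2 : (0.6931471803 : ℝ) < Real.log 2 := Real.log_two_gt_d9
  have hj0 : (0 : ℝ) < j + 1 := by positivity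
  have h2j : (0 : ℝ) < 2 ^ j := by positivity
  have hlogpow : Real.log ((2 ^ (j + 1) : ℕ) : ℝ) = (j + 1) * Real.log 2 := by
    push_cast
    rw [Real.log_pow]; push_cast; ring
  rw [hlogpow, div_le_div_iff₀ (by positivity) hj0]
  push_cast
  rw [pow_succ]
  nlinarith [mul_pos h2j hj0]

/-! ### Two elementary inequalities -/

/-- `1 − e^{−u log 2} = 1 − 2^{−u} ≥ 2u/5` for `0 ≤ u ≤ 1` (`e^{−x} ≤ 1/(1+x)`). [folklore] -/
theorem two_fifths_mul_le_one_sub_exp_neg {u : ℝ} (hu : 0 ≤ u) (hu1 : u ≤ 1) :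
    2 * u / 5 ≤ 1 - Real.exp (-(u * Real.log 2)) := by
  have hlog2 : (0.6931471803 : ℝ) < Real.log 2 := Real.log_two_gt_d9
  have hlog2' : Real.log 2 < 0.6931471808 := Real.log_two_lt_d9
  set x : ℝ := u * Real.log 2 with hx
  have hx0 : 0 ≤ x := by positivity
  have h1 : Real.exp (-x) ≤ 1 / (1 + x) := by
    rw [le_div_iff₀ (by linarith), Real.exp_neg]
    have := Real.add_one_le_exp x
    have hpos := Real.exp_pos x
    calc (Real.exp x)⁻¹ * (1 + x) ≤ (Real.exp x)⁻¹ * Real.exp x := by gcongr; linarith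
      _ = 1 := inv_mul_cancel₀ hpos.ne'
  have h2 : 2 * u / 5 ≤ 1 - 1 / (1 + x) := by
    rw [show 1 - 1 / (1 + x) = x / (1 + x) by field_simp; ring,
      div_le_div_iff₀ (by norm_num) (by linarith)]
    rw [hx]; nlinarith
  linarith

/-- `y^k ≤ k! e^{b y} / b^k` for `b > 0`, `y ≥ 0`. [folklore] -/
theorem pow_le_factorial_mul_exp_div {b : ℝ} (hb : 0 < b) (k : ℕ) {y : ℝ} (hy : 0 ≤ y) :
    y ^ k ≤ k.factorial * Real.exp (b * y) / b ^ k := by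
  have hx : 0 ≤ b * y := by positivity
  have hfac := Real.pow_div_factorial_le_exp (b * y) hx k
  have hmf : (0 : ℝ) < k.factorial := by exact_mod_cast Nat.factorial_pos k
  rw [div_le_iff₀ hmf, mul_pow] at hfac
  rw [le_div_iff₀ (by positivity)]
  linarith [mul_comm (b ^ k) (y ^ k)]

/-! ### The block lemma: `Σ_p (log p)^{k+1} p^{−1−2u} ≪_k u^{−k−1}` -/

/-- **Block lemma.** For `0 < u ≤ 1`, every `k` and every finite set `S` of primes,
`Σ_{p ∈ S} (log p)^{k+1} p^{−(1+2u)} ≤ 60 · k! · u^{−(k+1)}`.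
On the block `2^j ≤ p < 2^{j+1}` each term is at most `((j+1) log 2)^{k+1} e^{−(1+2u) j log 2}` and there
are at most `15 · 2^j/(j+1)` primes, so the block contributes at most
`15 (log 2)^{k+1} (j+1)^k e^{−2uj log 2}`; with `(j+1)^k ≤ k! e^{b(j+1)}/b^k`, `b = u log 2`, and
`Σ_j e^{−bj} ≤ 1/(1 − e^{−b}) ≤ 5/(2u)` the total is at most
`15 (log 2)^{k+1} k! (u log 2)^{−k} e^{b} · 5/(2u) ≤ 60 k!/u^{k+1}`. [cite: Titchmarsh1986, §14.22] -/
theorem sum_log_pow_mul_rpow_le (k : ℕ) {u : ℝ} (hu : 0 < u) (hu1 : u ≤ 1) (S : Finset ℕ)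
    (hS : ∀ p ∈ S, p.Prime) :
    ∑ p ∈ S, Real.log p ^ (k + 1) * (p : ℝ) ^ (-(1 + 2 * u)) ≤ 60 * k.factorial / u ^ (k + 1) := by
  classical
  have hlog2 : (0.6931471803 : ℝ) < Real.log 2 := Real.log_two_gt_d9
  have hlog2' : Real.log 2 < 0.6931471808 := Real.log_two_lt_d9
  have hl0 : 0 < Real.log 2 := by linarith
  set b : ℝ := u * Real.log 2 with hb
  have hb0 : 0 < b := by positivity
  have hmf : (0 : ℝ) < k.factorial := by exact_mod_cast Nat.factorial_pos k
  set q : ℝ := Real.exp (-b) with hq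
  have hq0 : 0 ≤ q := (Real.exp_pos _).le
  have hq1 : q < 1 := by
    rw [hq]; have := Real.exp_lt_exp.2 (show -b < 0 by linarith); rwa [Real.exp_zero] at this
  -- the block index and its range
  set J : ℕ := S.sup id with hJ
  have hmaps : ∀ p ∈ S, Nat.log 2 p ∈ Finset.range (Nat.log 2 J + 1) := by
    intro p hp
    rw [Finset.mem_range, Nat.lt_add_one_iff]
    exact Nat.log_mono_right (Finset.le_sup (f := id) hp)
  -- termwise bound on a block: `term(p) ≤ ((j+1) log 2)^{k+1} e^{−(1+2u) j log 2}`
  set B : ℕ → ℝ := fun j ↦ (((j : ℝ) + 1) * Real.log 2) ^ (k + 1) *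
    Real.exp (-((1 + 2 * u) * (j * Real.log 2))) with hB
  have hB0 : ∀ j, 0 ≤ B j := fun j ↦ by positivity
  have hterm : ∀ p ∈ S, Real.log p ^ (k + 1) * (p : ℝ) ^ (-(1 + 2 * u)) ≤ B (Nat.log 2 p) := by
    intro p hp
    set j := Nat.log 2 p with hj
    have hpp := hS p hp
    have hp2 : (2 : ℝ) ≤ p := by exact_mod_cast hpp.two_le
    have hp0 : (0 : ℝ) < p := by linarith
    have hlow : (2 : ℝ) ^ j ≤ p := by
      have := Nat.pow_log_le_self 2 hpp.ne_zero
      rw [← hj] at this; exact_mod_cast this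
    have hup : (p : ℝ) ≤ 2 ^ (j + 1) := by
      have := Nat.lt_pow_succ_log_self (b := 2) (by norm_num) p
      rw [← hj] at this; exact_mod_cast this.le
    have hlogp : Real.log p ≤ (j + 1) * Real.log 2 := by
      have := Real.log_le_log hp0 hup
      rw [Real.log_pow] at this; push_cast at this; linarith
    have hlogp' : j * Real.log 2 ≤ Real.log p := by
      have := Real.log_le_log (by positivity) hlow
      rw [Real.log_pow] at this; exact this
    have hlog0 : 0 ≤ Real.log p := Real.log_nonneg (by linarith)
    simp only [hB]
    refine mul_le_mul (pow_le_pow_left₀ hlog0 hlogp _) ?_ (Real.rpow_nonneg hp0.le _) (by positivity)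
    rw [Real.rpow_def_of_pos hp0]
    refine Real.exp_le_exp.2 ?_
    have h12 : 0 ≤ 1 + 2 * u := by linarith
    nlinarith
  -- Step 1: regroup by blocks and bound each block
  have step1 : ∑ p ∈ S, Real.log p ^ (k + 1) * (p : ℝ) ^ (-(1 + 2 * u)) ≤
      ∑ j ∈ Finset.range (Nat.log 2 J + 1), (15 * 2 ^ j / (j + 1)) * B j := by
    rw [← Finset.sum_fiberwise_of_maps_to hmaps]
    refine Finset.sum_le_sum fun j _ ↦ ?_
    calc ∑ p ∈ S with Nat.log 2 p = j, Real.log p ^ (k + 1) * (p : ℝ) ^ (-(1 + 2 * u))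
        ≤ ∑ p ∈ S with Nat.log 2 p = j, B j := by
          refine Finset.sum_le_sum fun p hp ↦ ?_
          rw [Finset.mem_filter] at hp
          have := hterm p hp.1
          rwa [hp.2] at this
      _ = ((S.filter fun p ↦ Nat.log 2 p = j).card : ℝ) * B j := by
          rw [Finset.sum_const, nsmul_eq_mul]
      _ ≤ (15 * 2 ^ j / (j + 1)) * B j :=
          mul_le_mul_of_nonneg_right (card_block_le S hS j) (hB0 j)
  -- Step 2: `(15 · 2^j/(j+1)) B_j ≤ A q^j`, `A = 15 (log 2)^{k+1} k! e^b / b^k`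
  set A : ℝ := 15 * Real.log 2 ^ (k + 1) * (k.factorial * Real.exp b / b ^ k) with hA
  have hA0 : 0 ≤ A := by positivity
  have step2 : ∀ j : ℕ, (15 * 2 ^ j / (j + 1)) * B j ≤ A * q ^ j := by
    intro j
    have hj0 : (0 : ℝ) < j + 1 := by positivity
    -- rewrite the block bound as `15 (log 2)^{k+1} (j+1)^k e^{-2uj log 2}`
    have hexp : Real.exp (-((1 + 2 * u) * (j * Real.log 2))) =
        ((2 : ℝ) ^ j)⁻¹ * Real.exp (-(2 * b * j)) := by
      rw [show -((1 + 2 * u) * (j * Real.log 2)) = -(j * Real.log 2) + -(2 * b * j) by rw [hb]; ring,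
        Real.exp_add, Real.exp_neg, ← Real.log_pow, Real.exp_log (by positivity)]
    have e1 : (15 * 2 ^ j / (j + 1)) * B j =
        15 * Real.log 2 ^ (k + 1) * ((j : ℝ) + 1) ^ k * Real.exp (-(2 * b * j)) := by
      simp only [hB]
      rw [hexp, mul_pow, pow_succ ((j : ℝ) + 1)]
      field_simp
    rw [e1]
    -- `(j+1)^k ≤ k! e^{b(j+1)}/b^k` and `e^{b(j+1)} e^{-2bj} = e^b q^j`
    have hpow := pow_le_factorial_mul_exp_div hb0 k (show (0 : ℝ) ≤ j + 1 by positivity)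
    have e2 : Real.exp (b * (j + 1)) * Real.exp (-(2 * b * j)) = Real.exp b * q ^ j := by
      rw [hq, ← Real.exp_nat_mul, ← Real.exp_add, ← Real.exp_add]
      congr 1; ring
    calc 15 * Real.log 2 ^ (k + 1) * ((j : ℝ) + 1) ^ k * Real.exp (-(2 * b * j))
        ≤ 15 * Real.log 2 ^ (k + 1) * (k.factorial * Real.exp (b * (j + 1)) / b ^ k) *
            Real.exp (-(2 * b * j)) := by gcongr
      _ = 15 * Real.log 2 ^ (k + 1) * (k.factorial / b ^ k) *
            (Real.exp (b * (j + 1)) * Real.exp (-(2 * b * j))) := by ring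
      _ = A * q ^ j := by rw [e2, hA]; ring
  -- Step 3: the geometric sum and the constant
  have step3 : ∑ j ∈ Finset.range (Nat.log 2 J + 1), A * q ^ j ≤ A * (1 / (1 - q)) := by
    have hgeomsum : ∀ {r : ℝ}, 0 ≤ r → r < 1 → ∀ n : ℕ, ∑ j ∈ Finset.range n, r ^ j ≤ 1 / (1 - r) := by
      intro r h0 h1 n
      rw [geom_sum_eq h1.ne n]
      have e : (r ^ n - 1) / (r - 1) = (1 - r ^ n) / (1 - r) := by
        rw [← neg_sub (r ^ n) 1, ← neg_sub r 1, neg_div_neg_eq]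
      rw [e]
      have : 0 ≤ r ^ n := pow_nonneg h0 n
      exact div_le_div_of_nonneg_right (by linarith) (by linarith)
    rw [← Finset.mul_sum]
    exact mul_le_mul_of_nonneg_left (hgeomsum hq0 hq1 _) hA0
  have h1q : 2 * u / 5 ≤ 1 - q := by
    rw [hq, hb]; exact two_fifths_mul_le_one_sub_exp_neg hu.le hu1
  have hexpb : Real.exp b ≤ 2 := by
    have : b ≤ Real.log 2 := by rw [hb]; nlinarith
    have := Real.exp_le_exp.2 this
    rwa [Real.exp_log (by norm_num)] at this
  have step4 : A * (1 / (1 - q)) ≤ 60 * k.factorial / u ^ (k + 1) := by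
    have h1q0 : 0 < 1 - q := by linarith
    rw [mul_one_div, div_le_div_iff₀ h1q0 (by positivity)]
    -- `A u^{k+1} ≤ 60 k! (1 - q)`: `A u^{k+1} = 15 (log 2) k! e^b u · (log 2)^k u^k / b^k = 15 log 2 · k! e^b u`
    have hbk : b ^ k = u ^ k * Real.log 2 ^ k := by rw [hb, mul_pow]
    have eA : A * u ^ (k + 1) = 15 * Real.log 2 * k.factorial * Real.exp b * u := by
      rw [hA, hbk, pow_succ, pow_succ]
      have h1 : u ^ k ≠ 0 := pow_ne_zero _ hu.ne'
      have h2 : Real.log 2 ^ k ≠ 0 := pow_ne_zero _ hl0.ne'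
      field_simp
    rw [eA]
    have hk0 : (0 : ℝ) ≤ k.factorial * u := by positivity
    calc 15 * Real.log 2 * k.factorial * Real.exp b * u
        ≤ 15 * 0.6931471808 * k.factorial * 2 * u := by
          have : Real.log 2 * Real.exp b ≤ 0.6931471808 * 2 :=
            mul_le_mul hlog2'.le hexpb (Real.exp_pos _).le (by norm_num)
          nlinarith
      _ ≤ 60 * k.factorial * (2 * u / 5) := by nlinarith
      _ ≤ 60 * k.factorial * (1 - q) := by gcongr
  calc ∑ p ∈ S, Real.log p ^ (k + 1) * (p : ℝ) ^ (-(1 + 2 * u))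
      ≤ ∑ j ∈ Finset.range (Nat.log 2 J + 1), (15 * 2 ^ j / (j + 1)) * B j := step1
    _ ≤ ∑ j ∈ Finset.range (Nat.log 2 J + 1), A * q ^ j := Finset.sum_le_sum fun j _ ↦ step2 j
    _ ≤ A * (1 / (1 - q)) := step3
    _ ≤ 60 * k.factorial / u ^ (k + 1) := step4

/-- The block lemma over the primes `p ≤ X`, in the two shapes used for Selberg's prime
polynomials: `Σ_{p ≤ X} log² p · p^{−1−2u} ≤ 60/u²` and `Σ_{p ≤ X} log⁴ p · p^{−1−2u} ≤ 360/u⁴`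
(`0 < u ≤ 1`). [cite: Titchmarsh1986, §14.22] -/
theorem sum_log_sq_mul_rpow_le {u : ℝ} (hu : 0 < u) (hu1 : u ≤ 1) (X : ℕ) :
    ∑ p ∈ Nat.primesLE X, Real.log p ^ 2 * (p : ℝ) ^ (-(1 + 2 * u)) ≤ 60 / u ^ 2 := by
  have := sum_log_pow_mul_rpow_le 1 hu hu1 (Nat.primesLE X) (fun p hp ↦ Nat.prime_of_mem_primesLE hp)
  simpa using this

/-- `Σ_{p ≤ X} log⁴ p · p^{−1−2u} ≤ 360/u⁴` for `0 < u ≤ 1`. [cite: Titchmarsh1986, §14.22] -/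
theorem sum_log_pow_four_mul_rpow_le {u : ℝ} (hu : 0 < u) (hu1 : u ≤ 1) (X : ℕ) :
    ∑ p ∈ Nat.primesLE X, Real.log p ^ 4 * (p : ℝ) ^ (-(1 + 2 * u)) ≤ 360 / u ^ 4 := by
  have := sum_log_pow_mul_rpow_le 3 hu hu1 (Nat.primesLE X) (fun p hp ↦ Nat.prime_of_mem_primesLE hp)
  have h6 : ((Nat.factorial 3 : ℕ) : ℝ) = 6 := by norm_num [Nat.factorial]
  rw [h6] at this
  linarith

/-! ### Mertens-type sums -/

/-- `Σ_{p ≤ y} log² p / p ≤ log y · (log y + 2)` for `y ≥ 1` (termwise `log p ≤ log y`, then the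
upper half of Mertens' first theorem `Σ_{p ≤ y} log p / p ≤ log y + 2`).
[cite: HardyWright2008, Thm 425 (§22.6)] -/
theorem sum_log_sq_div_le {y : ℝ} (hy : 1 ≤ y) :
    ∑ p ∈ Nat.primesLE ⌊y⌋₊, Real.log p ^ 2 / p ≤ Real.log y * (Real.log y + 2) := by
  have hM := (Literature.NumberTheory.LFunctions.MertensBound.sum_log_div_prime_bounds hy).2
  have hlogy : 0 ≤ Real.log y := Real.log_nonneg hy
  calc ∑ p ∈ Nat.primesLE ⌊y⌋₊, Real.log p ^ 2 / p
      ≤ ∑ p ∈ Nat.primesLE ⌊y⌋₊, Real.log y * (Real.log p / p) := by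
        refine Finset.sum_le_sum fun p hp ↦ ?_
        rw [Nat.mem_primesLE] at hp
        have hp0 : (0 : ℝ) < p := by exact_mod_cast hp.2.pos
        have hpy : (p : ℝ) ≤ y := (Nat.le_floor_iff (by linarith)).1 hp.1
        have hlogp : Real.log p ≤ Real.log y := Real.log_le_log hp0 hpy
        have hlogp0 : 0 ≤ Real.log p := Real.log_nonneg (by exact_mod_cast hp.2.one_lt.le)
        rw [pow_two, mul_div_assoc]
        exact mul_le_mul_of_nonneg_right hlogp (div_nonneg hlogp0 hp0.le)
    _ = Real.log y * ∑ p ∈ Nat.primesLE ⌊y⌋₊, Real.log p / p := by rw [Finset.mul_sum]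
    _ ≤ Real.log y * (Real.log y + 2) := mul_le_mul_of_nonneg_left hM hlogy

/-- **Mertens' second theorem in a window**: for `2 ≤ y ≤ X`,
`Σ_{y < p ≤ X} 1/p ≤ log log X − log log y + 16/log y`.
[cite: HardyWright2008, Thm 427 (§22.7)] -/
theorem sum_inv_primes_window_le {X y : ℝ} (hy : 2 ≤ y) (hyX : y ≤ X) :
    ∑ p ∈ (Nat.primesLE ⌊X⌋₊).filter (fun p : ℕ => y < (p : ℝ)), (p : ℝ)⁻¹ ≤
      Real.log (Real.log X) - Real.log (Real.log y) + 16 / Real.log y := by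
  -- `Σ_{p ≤ X, y < p} = Σ_{p ≤ X} − Σ_{p ≤ y}`
  have hsplit := Finset.sum_filter_add_sum_filter_not (Nat.primesLE ⌊X⌋₊) (fun p : ℕ => y < (p : ℝ))
    (fun p : ℕ => (p : ℝ)⁻¹)
  have hset : (Nat.primesLE ⌊X⌋₊).filter (fun p : ℕ => ¬ y < (p : ℝ)) = Nat.primesLE ⌊y⌋₊ := by
    ext p
    simp only [Finset.mem_filter, Nat.mem_primesLE, not_lt]
    constructor
    · rintro ⟨⟨-, hp⟩, hpy⟩
      exact ⟨Nat.le_floor hpy, hp⟩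
    · rintro ⟨hpy, hp⟩
      have h1 : (p : ℝ) ≤ y := (Nat.le_floor_iff (by linarith)).mp hpy
      exact ⟨⟨Nat.le_floor (h1.trans hyX), hp⟩, h1⟩
  rw [hset] at hsplit
  have hsub : ∑ p ∈ (Nat.primesLE ⌊X⌋₊).filter (fun p : ℕ => y < (p : ℝ)), (p : ℝ)⁻¹ =
      ∑ p ∈ Nat.primesLE ⌊X⌋₊, (p : ℝ)⁻¹ - ∑ p ∈ Nat.primesLE ⌊y⌋₊, (p : ℝ)⁻¹ := by linarith
  rw [hsub]
  have hX := Literature.NumberTheory.LFunctions.Mertens.abs_primeRecipSum_sub_le (x := X) (by linarith)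
  have hY := Literature.NumberTheory.LFunctions.Mertens.abs_primeRecipSum_sub_le (x := y) hy
  rw [Literature.NumberTheory.LFunctions.Mertens.primeRecipSum, abs_le] at hX hY
  have hlogy : 0 < Real.log y := Real.log_pos (by linarith)
  have hlogX : Real.log y ≤ Real.log X := Real.log_le_log (by linarith) hyX
  have h8 : 8 / Real.log X ≤ 8 / Real.log y := div_le_div_of_nonneg_left (by norm_num) hlogy hlogX
  have e16 : 16 / Real.log y = 8 / Real.log y + 8 / Real.log y := by ring
  linarith [hX.2, hY.1]

/-! ### The higher prime powers -/

/-- **The prime powers `p^k`, `k ≥ 2`, below `N`.** For a non-negative `G`,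
`Σ_{n < N, n not prime, n a prime power} G(n) ≤ Σ_{p ≤ N} Σ_{2 ≤ k ≤ N} G(p^k)`
(such an `n` is `p^k` with `p = minFac n` prime and `2 ≤ k < N`; the map `k ↦ p^k` is injective).
[folklore] -/
theorem sum_nonprime_primePow_le (N : ℕ) {G : ℕ → ℝ} (hG : ∀ n, 0 ≤ G n) :
    ∑ n ∈ ((Finset.range N).filter (fun n ↦ ¬ n.Prime)).filter (fun n ↦ IsPrimePow n), G n ≤
      ∑ p ∈ Nat.primesLE N, ∑ k ∈ Finset.Icc 2 N, G (p ^ k) := by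
  classical
  set S' := ((Finset.range N).filter (fun n ↦ ¬ n.Prime)).filter (fun n ↦ IsPrimePow n) with hS'def
  have hmaps : ∀ n ∈ S', n.minFac ∈ Nat.primesLE N := by
    intro n hn
    rw [hS'def, Finset.mem_filter, Finset.mem_filter, Finset.mem_range] at hn
    rw [Nat.mem_primesLE]
    exact ⟨(Nat.minFac_le hn.2.pos).trans hn.1.1.le, Nat.minFac_prime hn.2.ne_one⟩
  rw [← Finset.sum_fiberwise_of_maps_to hmaps]
  refine Finset.sum_le_sum fun p hp ↦ ?_
  have hpp := Nat.prime_of_mem_primesLE hp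
  have hfib : ∀ n ∈ S'.filter (fun n ↦ n.minFac = p), ∃ k ∈ Finset.Icc 2 N, p ^ k = n := by
    intro n hn
    rw [Finset.mem_filter, hS'def, Finset.mem_filter, Finset.mem_filter, Finset.mem_range] at hn
    obtain ⟨⟨⟨hnN, hnp⟩, hpow⟩, hmin⟩ := hn
    obtain ⟨q, k, hq, hk, rfl⟩ := (isPrimePow_nat_iff _).1 hpow
    have hqp : q = p := by rw [← hmin, hq.pow_minFac hk.ne']
    subst hqp
    refine ⟨k, Finset.mem_Icc.2 ⟨?_, ?_⟩, rfl⟩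
    · by_contra hk2
      have : k = 1 := by omega
      subst this
      exact hnp (by simpa using hq)
    · calc k ≤ q ^ k := (Nat.lt_pow_self hq.one_lt).le
        _ ≤ N := hnN.le
  have hinj : Set.InjOn (fun k : ℕ ↦ p ^ k) (Finset.Icc 2 N : Set ℕ) :=
    fun a _ b _ hab ↦ Nat.pow_right_injective hpp.two_le hab
  rw [← Finset.sum_image (f := G) hinj]
  refine Finset.sum_le_sum_of_subset_of_nonneg (fun n hn ↦ ?_) (fun n _ _ ↦ hG n)
  obtain ⟨k, hk, rfl⟩ := hfib n hn
  exact Finset.mem_image.2 ⟨k, hk, rfl⟩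

/-- **The prime powers `p^k`, `k ≥ 2`, below `N`, with the von Mangoldt weight.** For a non-negative
`g`, `Σ_{n < N, n not prime} Λ(n) g(n) ≤ Σ_{p ≤ N} log p · Σ_{2 ≤ k ≤ N} g(p^k)`. [folklore] -/
theorem sum_nonprime_vonMangoldt_mul_le (N : ℕ) {g : ℕ → ℝ} (hg : ∀ n, 0 ≤ g n) :
    ∑ n ∈ (Finset.range N).filter (fun n ↦ ¬ n.Prime), ArithmeticFunction.vonMangoldt n * g n ≤
      ∑ p ∈ Nat.primesLE N, Real.log p * ∑ k ∈ Finset.Icc 2 N, g (p ^ k) := by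
  classical
  set S := (Finset.range N).filter (fun n ↦ ¬ n.Prime) with hSdef
  -- restrict to prime powers (elsewhere `Λ = 0`)
  have hrestrict : ∑ n ∈ S, ArithmeticFunction.vonMangoldt n * g n =
      ∑ n ∈ S.filter (fun n ↦ IsPrimePow n), ArithmeticFunction.vonMangoldt n * g n := by
    refine (Finset.sum_filter_of_ne fun n _ hne ↦ ?_).symm
    by_contra h
    apply hne
    rw [ArithmeticFunction.vonMangoldt_apply]
    simp [h]
  rw [hrestrict]
  have h1 := sum_nonprime_primePow_le N (G := fun n ↦ ArithmeticFunction.vonMangoldt n * g n)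
    (fun n ↦ mul_nonneg ArithmeticFunction.vonMangoldt_nonneg (hg n))
  refine h1.trans (le_of_eq (Finset.sum_congr rfl fun p hp ↦ ?_))
  have hpp := Nat.prime_of_mem_primesLE hp
  rw [Finset.mul_sum]
  refine Finset.sum_congr rfl fun k hk ↦ ?_
  have hk0 : k ≠ 0 := by have := (Finset.mem_Icc.1 hk).1; omega
  rw [ArithmeticFunction.vonMangoldt_apply_pow hk0, ArithmeticFunction.vonMangoldt_apply_prime hpp]

/-- A truncated geometric series started at `k = 2`: `Σ_{2 ≤ k ≤ K} r^k ≤ 4 r²` for `0 ≤ r ≤ 3/4`.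
[folklore] -/
theorem sum_Icc_two_pow_le {r : ℝ} (hr0 : 0 ≤ r) (hr : r ≤ 3 / 4) (K : ℕ) :
    ∑ k ∈ Finset.Icc 2 K, r ^ k ≤ 4 * r ^ 2 := by
  have hsub : ∑ k ∈ Finset.Icc 2 K, r ^ k ≤ r ^ 2 * ∑ i ∈ Finset.range (K - 1), r ^ i := by
    rcases lt_or_ge K 2 with hK | hK
    · rw [Finset.Icc_eq_empty_of_lt hK, Finset.sum_empty]
      exact mul_nonneg (sq_nonneg _) (Finset.sum_nonneg fun i _ ↦ pow_nonneg hr0 i)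
    · rw [Finset.mul_sum]
      have e : Finset.Icc 2 K = (Finset.range (K - 1)).image (fun i ↦ i + 2) := by
        ext k
        simp only [Finset.mem_Icc, Finset.mem_image, Finset.mem_range]
        constructor
        · intro h; exact ⟨k - 2, by omega, by omega⟩
        · rintro ⟨i, hi, rfl⟩; omega
      rw [e, Finset.sum_image (fun a _ b _ h ↦ by simpa using h)]
      exact le_of_eq (Finset.sum_congr rfl fun i _ ↦ by ring)
  have hgeom : ∑ i ∈ Finset.range (K - 1), r ^ i ≤ 1 / (1 - r) := by
    rw [geom_sum_eq (by linarith : r ≠ 1) (K - 1)]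
    have e : (r ^ (K - 1) - 1) / (r - 1) = (1 - r ^ (K - 1)) / (1 - r) := by
      rw [← neg_sub (r ^ (K - 1)) 1, ← neg_sub r 1, neg_div_neg_eq]
    rw [e]
    have : 0 ≤ r ^ (K - 1) := pow_nonneg hr0 _
    exact div_le_div_of_nonneg_right (by linarith) (by linarith)
  calc ∑ k ∈ Finset.Icc 2 K, r ^ k ≤ r ^ 2 * ∑ i ∈ Finset.range (K - 1), r ^ i := hsub
    _ ≤ r ^ 2 * (1 / (1 - r)) := mul_le_mul_of_nonneg_left hgeom (sq_nonneg r)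
    _ ≤ r ^ 2 * 4 := by
        refine mul_le_mul_of_nonneg_left ?_ (sq_nonneg r)
        rw [div_le_iff₀ (by linarith)]; linarith
    _ = 4 * r ^ 2 := by ring

/-- `Σ_{2 ≤ k ≤ K} (p^k)^{−1/2} ≤ 4/p` for `p ≥ 2` (ratio `p^{−1/2} ≤ 2^{−1/2} ≤ 3/4`). [folklore] -/
theorem sum_Icc_rpow_neg_half_le {p : ℕ} (hp : 2 ≤ p) (K : ℕ) :
    ∑ k ∈ Finset.Icc 2 K, ((p : ℝ) ^ k) ^ (-(1 / 2 : ℝ)) ≤ 4 / p := by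
  have hp0 : (0 : ℝ) < p := by exact_mod_cast (show 0 < p by omega)
  have hp2 : (2 : ℝ) ≤ p := by exact_mod_cast hp
  set r : ℝ := (p : ℝ) ^ (-(1 / 2 : ℝ)) with hr
  have hr0 : 0 < r := Real.rpow_pos_of_pos hp0 _
  have hr2 : r ^ 2 = (p : ℝ)⁻¹ := by
    rw [hr, ← Real.rpow_natCast, ← Real.rpow_mul hp0.le]
    norm_num
    exact Real.rpow_neg_one (p : ℝ)
  have hr34 : r ≤ 3 / 4 := by
    have h1 : r ^ 2 ≤ 1 / 2 := by
      rw [hr2, inv_eq_one_div]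
      exact div_le_div_of_nonneg_left (by norm_num) (by norm_num) hp2
    nlinarith
  have hterm : ∀ k : ℕ, ((p : ℝ) ^ k) ^ (-(1 / 2 : ℝ)) = r ^ k := by
    intro k
    rw [hr, ← Real.rpow_natCast, ← Real.rpow_mul hp0.le, ← Real.rpow_natCast,
      ← Real.rpow_mul hp0.le, mul_comm]
  simp_rw [hterm]
  calc ∑ k ∈ Finset.Icc 2 K, r ^ k ≤ 4 * r ^ 2 := sum_Icc_two_pow_le hr0.le hr34 K
    _ = 4 / p := by rw [hr2]; ring

/-- `Σ_{2 ≤ k ≤ K} (p^k)^{−1} ≤ 4/(p(p−1))` for `p ≥ 2`. [folklore] -/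
theorem sum_Icc_pow_inv_le {p : ℕ} (hp : 2 ≤ p) (K : ℕ) :
    ∑ k ∈ Finset.Icc 2 K, (((p : ℝ) ^ k))⁻¹ ≤ 4 * (1 / ((p : ℝ) * (p - 1))) := by
  have hp2 : (2 : ℝ) ≤ p := by exact_mod_cast hp
  have hp0 : (0 : ℝ) < p := by linarith
  have hterm : ∀ k : ℕ, (((p : ℝ) ^ k))⁻¹ = ((p : ℝ)⁻¹) ^ k := fun k ↦ by rw [inv_pow]
  simp_rw [hterm]
  have hr : (p : ℝ)⁻¹ ≤ 3 / 4 := by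
    rw [inv_eq_one_div, div_le_iff₀ hp0]; linarith
  calc ∑ k ∈ Finset.Icc 2 K, ((p : ℝ)⁻¹) ^ k ≤ 4 * ((p : ℝ)⁻¹) ^ 2 :=
        sum_Icc_two_pow_le (inv_nonneg.2 hp0.le) hr K
    _ ≤ 4 * (1 / ((p : ℝ) * (p - 1))) := by
        refine mul_le_mul_of_nonneg_left ?_ (by norm_num)
        rw [inv_pow, inv_eq_one_div]
        exact div_le_div_of_nonneg_left (by norm_num) (by nlinarith) (by nlinarith)

/-- **`Σ_{n < N, n not prime} Λ(n) n^{−1/2} ≤ 4 log N + 6`**: by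
`sum_nonprime_vonMangoldt_mul_le`, `Σ_k (p^k)^{−1/2} ≤ 4/p` and Mertens I
(`Σ_{p ≤ N} log p/p ≤ log N + log 4`). [cite: HardyWright2008, Thm 425 (§22.6)] -/
theorem sum_nonprime_vonMangoldt_rpow_le (N : ℕ) :
    ∑ n ∈ (Finset.range N).filter (fun n ↦ ¬ n.Prime),
        ArithmeticFunction.vonMangoldt n * (n : ℝ) ^ (-(1 / 2 : ℝ)) ≤ 4 * Real.log N + 6 := by
  have h1 := sum_nonprime_vonMangoldt_mul_le N (g := fun n ↦ (n : ℝ) ^ (-(1 / 2 : ℝ)))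
    (fun n ↦ Real.rpow_nonneg (Nat.cast_nonneg n) _)
  refine h1.trans ?_
  have h2 : ∑ p ∈ Nat.primesLE N, Real.log p * ∑ k ∈ Finset.Icc 2 N, (((p ^ k : ℕ) : ℝ)) ^ (-(1 / 2 : ℝ)) ≤
      ∑ p ∈ Nat.primesLE N, 4 * (Real.log p / p) := by
    refine Finset.sum_le_sum fun p hp ↦ ?_
    have hpp := Nat.prime_of_mem_primesLE hp
    have hlog0 : 0 ≤ Real.log p := Real.log_nonneg (by exact_mod_cast hpp.one_lt.le)
    have := sum_Icc_rpow_neg_half_le hpp.two_le N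
    push_cast at this ⊢
    calc Real.log p * ∑ k ∈ Finset.Icc 2 N, ((p : ℝ) ^ k) ^ (-(1 / 2 : ℝ))
        ≤ Real.log p * (4 / p) := mul_le_mul_of_nonneg_left this hlog0
      _ = 4 * (Real.log p / p) := by ring
  refine h2.trans ?_
  rw [← Finset.mul_sum]
  have hM := Literature.NumberTheory.LFunctions.MertensBound.sum_log_div_prime_le N
  have hl4 : Real.log 4 ≤ 3 / 2 := by
    have := Real.log_two_lt_d9
    rw [show (4 : ℝ) = 2 ^ 2 by norm_num, Real.log_pow]; push_cast; linarith
  linarith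

/-- **`Σ_{n < N, n = p^k, k ≥ 2} 1/n ≤ 4`**: by `sum_nonprime_primePow_le`, `Σ_k p^{−k} ≤ 4/(p(p−1))`
and `Σ_p 1/(p(p−1)) ≤ 1` (`MertensBound.sum_inv_prime_mul_pred_le_one`). [folklore] -/
theorem sum_nonprime_primePow_inv_le (N : ℕ) :
    ∑ n ∈ ((Finset.range N).filter (fun n ↦ ¬ n.Prime)).filter (fun n ↦ IsPrimePow n), (n : ℝ)⁻¹ ≤ 4 := by
  have h1 := sum_nonprime_primePow_le N (G := fun n ↦ (n : ℝ)⁻¹) (fun n ↦ inv_nonneg.2 (Nat.cast_nonneg n))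
  refine h1.trans ?_
  have h2 : ∑ p ∈ Nat.primesLE N, ∑ k ∈ Finset.Icc 2 N, (((p ^ k : ℕ) : ℝ))⁻¹ ≤
      ∑ p ∈ Nat.primesLE N, 4 * (1 / ((p : ℝ) * (p - 1))) := by
    refine Finset.sum_le_sum fun p hp ↦ ?_
    have := sum_Icc_pow_inv_le (Nat.prime_of_mem_primesLE hp).two_le N
    push_cast at this ⊢
    exact this
  refine h2.trans ?_
  rw [← Finset.mul_sum]
  have := Literature.NumberTheory.LFunctions.MertensBound.sum_inv_prime_mul_pred_le_one N
  linarith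

end SelbergPrimes

end Literature.NumberTheory.LFunctions

end
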